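import Summits.RiemannHypothesis.RiemannHypothesis.Theorems.WeilFormatCDataO100FrontData
import Summits.RiemannHypothesis.RiemannHypothesis.Theorems.S2FormatCE0
import Literature.NumberTheory.LFunctions.YoshidaWindowGramTailMSSines
import Literature.NumberTheory.LFunctions.YoshidaWindowGramMiddleJBox
import Literature.NumberTheory.LFunctions.YoshidaWindowGramTailJFactoredScaled
import Literature.NumberTheory.LFunctions.YoshidaWindowGramTailMSFactored
import Literature.NumberTheory.LFunctions.YoshidaWindowGramTailJDiagTight
import Summits.RiemannHypothesis.RiemannHypothesis.Theorems.FormatCPsdBands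
import Summits.RiemannHypothesis.RiemannHypothesis.Theorems.WeilFormatCDiagShift
import HarnessLib

/-!
# [SYMMETRY BAND rows 104..135 of `O100CBOdd.DS'` against the lower triangle — replaces the single `checkPsdShapeFast` fact `tShape` (≈ 545–600 s of kernel time at n = 192, the gate-timeout class) via `FormatCPsd.checkPsdShape_of_symmBands` (prover A g23)]
# Format C kernel rung `O100` (a = 1/1, column-band layout): odd sector (P): dyadic-Cholesky row budgets, rows 168…191 + shape + assembly (kernel certificates)

Window `a = 1/1`; prime powers in the window: 2, 3, 2^2, 5, 7; prime constant A = 2027/1000 (`WeilFormatC.primeCoeff_form_ge_cells_one_v2`); evaluator parameters S = 2^256, Kpi 130, Kser 150, kred 8, Kexp 45, J 120; full table modes < 193; light column table modes < 1027; units 2^-250 (Schur entries), 2^-124 (column digits, width 127), 2^-118 (tail-factor digits, width 121), 2^-64 (reciprocal weights), 2^-40 (tail base); order-J tail J = 4, θ = 1/2048, η = 1/10 | 4/1.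
Design row: sr-gb-rung-a A g23 odd λ-run (parity cell 12 L-side): a = 1, μ = 2^-88, odd 192/384/1024, MS tail, five prime powers; see HOME(A)/LADDER-LSIDES-FORMATC-A-g22.md and <A g23 folder>/NOTES.md. Generated by sr-gb-rung-a prover A g22 with rh-explicit-weil-2 gen7's generator extended for the odd λ-run (--sector odd --mu-log2; HOME(A)/code-g22/gen7/gramgen7.py sha16 a23c12b0192f5d01) from `#eval` of the tree's `Encl` functions; every datum is re-verified by the kernel in the theorem files (`decide +kernel`). Helper data of the rh-explicit Weil-positivity programme (format C, K-CELL-2), RH-free. [cite: Yoshida1992HermitianForms, §5 (5.15)-(5.16) p. 301; §7 pp. 305–312]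
-/

set_option linter.dupNamespace false
set_option maxRecDepth 200000

namespace Summit.RiemannHypothesis.RiemannHypothesis.Theorems.WeilFormatCData.O100CBOdd

open Literature.NumberTheory.LFunctions Literature.NumberTheory.LFunctions.PsdDyadic Summit.RiemannHypothesis.RiemannHypothesis.Theorems.FormatCPsd
set_option maxHeartbeats 0 in
/-- kernel: symmetry of the rows `104 ≤ i < 136` of `DS'` against the lower triangle. -/
theorem tSy104 : (List.range' 104 32).all (fun i ↦ (List.range i).all fun j ↦ decide (PsdDyadic.getMZ O100CBOdd.DS' i j = PsdDyadic.getMZ O100CBOdd.DS' j i)) = true := by decide +kernel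

end Summit.RiemannHypothesis.RiemannHypothesis.Theorems.WeilFormatCData.O100CBOdd
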